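import Mathlib
import Literature.AlgebraicGeometry.Resolution.PointChartPresentation
import HarnessLib

/-!
# Cutkosky 2009, Def. 10.10 / proof of Thm. 10.18: a curve blow-up read in good parameters is a Tr3 (or Tr4) transformation (PROVED)

Topic: `Literature/AlgebraicGeometry/Resolution`.  S. D. Cutkosky, *Resolution of singularities for
3-folds in positive characteristic*, Amer. J. Math. **131** (2009) 59–127 [cite: Cutkosky2009],
Definition 10.10 (p. 31 l. 46 – p. 32 l. 4): Tr3 (`Sing_r(I) = V(x, z)`; `x = x₁, y = y₁, z = x₁ z₁`;
`I₁ = x₁^{-r} I T₁`) and Tr4 (`Sing_r(I) = V(y, z)`; `x = x₁, y = y₁, z = y₁ z₁`), and the proof of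
Theorem 10.18, p. 36 l. 84–88 / p. 37 l. 1–6: "If `Sing_r(I_n) = V(x_n, z_n)` then … `R_n → R_{n+1}`
must be a Tr3 transformation by Lemma 5.1, since `V(z_n)` is an approximate manifold of `I_n`."

In the `τ = 1` sequences of `CutkoskySurfaceOmegaSequence.lean` a CURVE step along the nonsingular
curve germ `P = (u 0, u 1)` is SOME presentation `φ(u 0) = u'_0`, `φ(u 1) = u'_0 u'_1`,
`φ(u 2) = u'_2` with weak transform `I' = (I R' : u'_0^r)`.  When `P = (z, x)` for good parameters
`c = (z, x, y)` this file proves, in a general local frame: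

* `mem_maximalIdeal_of_mul_pow_mem_pow_succ` — `s · u'_0^r ∈ 𝔪'^{r+1}` ⇒ `s ∈ 𝔪'` (a regular
  parameter has order exactly `1`; quasi-regularity);
* `colon_map_eq_top_of_monic_curve` — **Lemma 5.1 (2) on the fiber of the curve blow-up**: if the
  centre `q₁` of the chart is the point `z/u_0 ≠ 0` of the fiber (the coefficient of `u 0` in
  `z = α u_0 + β u_1` is a unit) and `I ⊆ P^r` contains `g ≡ a z^r (mod 𝔪^{r+1})`, `a` a unit, then
  `(I R' : u'_0^r) = R'` — the order has dropped; so at a near point `α ∈ 𝔪`;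
* `exists_curveChart_presentation` — **the Tr3 presentation**: if `α ∈ 𝔪` there are regular
  parameters `c' = (z₁, x₁, y₁)` of `R'` with `x₁ = φ(x)`, `φ(z) = x₁ z₁`, `y₁ = φ(y)` and
  `(x₁) = (u'_0)` — the chart hypotheses `(h₁, h₀, h₂)` of the tree's curve-chart files
  (`CurveBlowupPolygonLaws`, `CurveStepPrepared`, `CutkoskySurfaceOmegaCurveChart`).  Tr4 is the
  same statement for the system `(z, y, x)`.

Elementary linear algebra modulo `𝔪²` over the regular local ring (`mem_maximalIdeal_of_lin_mem_sq`
of `PointChartPresentation.lean`); Cutkosky prints no proof ("must be").  AI-written; weaker than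
expert review.  No definitions, no facts.

## Sources

* S. D. Cutkosky, Amer. J. Math. 131 (2009), Def. 10.10 p. 31 l. 46 – p. 32 l. 4; proof of
  Thm. 10.18 p. 36 l. 84 – p. 37 l. 6; Lemma 5.1 (2) p. 17 l. 46–50. [Cutkosky2009]
-/

noncomputable section

open IsLocalRing MvPolynomial

namespace Literature.AlgebraicGeometry.Resolution

universe u

section Order

variable {R : Type u} [CommRing R] [IsRegularLocalRing R] {u : Fin 3 → R}
  (hu : Ideal.span {u 0, u 1, u 2} = maximalIdeal R) (hdim : ringKrullDim R = 3)

include hu hdim in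
/-- `s · u₀^r ∈ 𝔪^{r+1}` ⇒ `s ∈ 𝔪` for a regular parameter `u₀` (quasi-regularity in degree `r`).
[cite: Matsumura1987, Thm. 17.10] -/
theorem mem_maximalIdeal_of_mul_pow_mem_pow_succ {s : R} {r : ℕ}
    (h : s * u 0 ^ r ∈ maximalIdeal R ^ (r + 1)) : s ∈ maximalIdeal R := by
  classical
  have hF : ∀ m ∈ (monomial (Finsupp.single (0 : Fin 3) r) s).support,
      Finsupp.weight (fun _ : Fin 3 => (1 : ℕ)) m = r := by
    intro m hm
    have := support_monomial_subset hm
    rw [Finset.mem_singleton] at this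
    subst this
    simp [Finsupp.weight_apply, Finsupp.sum_single_index]
  have hev : eval u (monomial (Finsupp.single (0 : Fin 3) r) s) ∈
      weightedIdealW u (fun _ : Fin 3 => (1 : ℕ)) (r + 1) := by
    rw [weightedIdealW_one_eq_pow u (span_range_eq_of_span_triple u hu), eval_monomial]
    simpa [Finsupp.prod_single_index] using h
  have := coeff_mem_maximalIdeal_of_weval_mem_general u hu hdim (fun _ => 1) (fun _ => Nat.one_pos)
    hF hev (Finsupp.single 0 r)
  simpa using this

end Order

section Curve

variable {R R' : Type u} [CommRing R] [CommRing R'] [IsLocalRing R] [IsRegularLocalRing R']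
  (φ : R →+* R') [IsLocalHom φ] {u : Fin 3 → R} {u' : Fin 3 → R'}

/-- **Cutkosky 2009, Lemma 5.1 (2) on the fiber of a curve blow-up** (the order drops off the
strict transform of the approximate hyperplane): `φ` a local homomorphism with `φ(u 0) = u'_0`,
`φ(u 1) = u'_0 u'_1` into a regular local ring of dimension `3` with regular parameters `u'`;
`z = α u_0 + β u_1` with `α` a UNIT; `g ∈ (u 0, u 1)^r` with `g ≡ a z^r (mod 𝔪^{r+1})`, `a` a unit.
Then `(J R' : u'_0^r) = R'` for every `J ∋ g`. [cite: Cutkosky2009, Lemma 5.1 (2), p. 17 l. 46–50] -/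
theorem colon_map_eq_top_of_monic_curve
    (hu' : Ideal.span {u' 0, u' 1, u' 2} = maximalIdeal R') (hdim' : ringKrullDim R' = 3)
    (h0 : φ (u 0) = u' 0) (h1 : φ (u 1) = u' 0 * u' 1)
    {J : Ideal R} {r : ℕ} {g z a α β : R} (hg : g ∈ J)
    (hgP : g ∈ Ideal.span {u 0, u 1} ^ r) (ha : IsUnit a)
    (hrem : g - a * z ^ r ∈ maximalIdeal R ^ (r + 1)) (hz : α * u 0 + β * u 1 = z) (hα : IsUnit α) :
    (J.map φ).colon (Ideal.span {u' 0 ^ r}) = ⊤ := by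
  classical
  have hu'i : ∀ i, u' i ∈ maximalIdeal R' := fun i => by
    rw [← hu']; exact Ideal.subset_span (by fin_cases i <;> simp)
  -- `φ(P) ⊆ (u'_0)`, hence `φ(P^r) ⊆ (u'_0^r)`
  have hmapP : (Ideal.span {u 0, u 1}).map φ ≤ Ideal.span {u' 0} := by
    rw [Ideal.map_span, Ideal.span_le]
    rintro _ ⟨v, hv, rfl⟩
    simp only [Set.mem_insert_iff, Set.mem_singleton_iff] at hv
    rcases hv with rfl | rfl
    · rw [h0]; exact Ideal.mem_span_singleton_self _
    · rw [h1]; exact Ideal.mul_mem_right _ _ (Ideal.mem_span_singleton_self _)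
  have hmapPr : (Ideal.span {u 0, u 1} ^ r).map φ ≤ Ideal.span {u' 0 ^ r} := by
    rw [Ideal.map_pow, ← Ideal.span_singleton_pow]; exact Ideal.pow_right_mono hmapP _
  -- the remainder `h = g − a z^r ∈ P^r ∩ 𝔪^{r+1}` maps into `u'_0^r · 𝔪'`
  have hzP : z ∈ Ideal.span ({u 0, u 1} : Set R) := by
    rw [← hz]
    exact Ideal.add_mem _ (Ideal.mul_mem_left _ _ (Ideal.subset_span (by simp)))
      (Ideal.mul_mem_left _ _ (Ideal.subset_span (by simp)))
  have hhP : g - a * z ^ r ∈ Ideal.span {u 0, u 1} ^ r :=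
    Ideal.sub_mem _ hgP (Ideal.mul_mem_left _ _ (Ideal.pow_mem_pow hzP r))
  obtain ⟨s, hs⟩ := Ideal.mem_span_singleton'.mp (hmapPr (Ideal.mem_map_of_mem φ hhP))
  have hs𝔪 : s ∈ maximalIdeal R' := by
    refine mem_maximalIdeal_of_mul_pow_mem_pow_succ hu' hdim' (r := r) ?_
    rw [hs]
    have hmap𝔪 : (maximalIdeal R).map φ ≤ maximalIdeal R' :=
      Ideal.map_le_iff_le_comap.mpr fun x hx => Ideal.mem_comap.mpr (map_nonunit φ x hx)
    have : (maximalIdeal R ^ (r + 1)).map φ ≤ maximalIdeal R' ^ (r + 1) := by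
      rw [Ideal.map_pow]; exact Ideal.pow_right_mono hmap𝔪 _
    exact this (Ideal.mem_map_of_mem φ hrem)
  -- `φ z = u'_0 · w`, `w` a unit
  set w : R' := φ α + φ β * u' 1 with hw
  have hφz : φ z = u' 0 * w := by rw [← hz]; simp only [map_add, map_mul, h0, h1, hw]; ring
  have hwU : IsUnit w :=
    isUnit_add_of_mem_maximalIdeal (hα.map φ) (Ideal.mul_mem_left _ _ (hu'i 1))
  -- `φ g = u'_0^r · (unit)`
  have hφg : φ g = u' 0 ^ r * (φ a * w ^ r + s) := by
    have e : φ g = φ (a * z ^ r) + φ (g - a * z ^ r) := by rw [← map_add]; ring_nf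
    rw [e, map_mul, map_pow, hφz, ← hs]; ring
  have hU : IsUnit (φ a * w ^ r + s) :=
    isUnit_add_of_mem_maximalIdeal ((ha.map φ).mul (hwU.pow r)) hs𝔪
  refine Ideal.eq_top_of_isUnit_mem _ ?_ hU
  rw [Submodule.mem_colon_span_singleton, smul_eq_mul, mul_comm, ← hφg]
  exact Ideal.mem_map_of_mem φ hg

end Curve

section Present

variable {R R' : Type u} [CommRing R] [CommRing R'] [IsRegularLocalRing R] [IsLocalRing R']
  (φ : R →+* R') [IsLocalHom φ] {c u : Fin 3 → R} {u' : Fin 3 → R'}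

/-- **Cutkosky 2009, Def. 10.10 / proof of Thm. 10.18 («must be a Tr3 transformation»), PROVED.**
`R` regular local of dimension `3` with regular systems `c = (z, x, y)` and `u`, the curve
`P = (z, x) = (u 0, u 1)`; `φ : R → R'` a local homomorphism presenting the origin of the `u 0`-chart
of the blow-up of `V(P)` (`𝔪' = (u'_0, u'_1, u'_2)`, `φ(u 0) = u'_0`, `φ(u 1) = u'_0 u'_1`,
`φ(u 2) = u'_2`); the centre is a near point: the `u 0`-coefficient `α` of `z = α u_0 + β u_1` lies
in `𝔪` (`colon_map_eq_top_of_monic_curve`).  THEN there are regular parameters `c' = (z₁, x₁, y₁)`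
of `R'` with `x₁ = φ(x)`, `φ(z) = x₁ z₁`, `y₁ = φ(y)` and `(x₁) = (u'_0)` (Tr3; Tr4 is the same
statement for `(z, y, x)`). [cite: Cutkosky2009, Def. 10.10, p. 31 l. 46 – p. 32 l. 4; proof of
Thm. 10.18, p. 37 l. 1–6] -/
theorem exists_curveChart_presentation
    (hgen : Ideal.span {c 0, c 1, c 2} = maximalIdeal R) (hdim : ringKrullDim R = 3)
    (hu : Ideal.span {u 0, u 1, u 2} = maximalIdeal R)
    (hu' : Ideal.span {u' 0, u' 1, u' 2} = maximalIdeal R')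
    (h0 : φ (u 0) = u' 0) (h1 : φ (u 1) = u' 0 * u' 1) (h2 : φ (u 2) = u' 2)
    (hP : Ideal.span {c 0, c 1} = Ideal.span {u 0, u 1})
    {α β : R} (hz : α * u 0 + β * u 1 = c 0) (hα : α ∈ maximalIdeal R) :
    ∃ c' : Fin 3 → R', Ideal.span {c' 0, c' 1, c' 2} = maximalIdeal R' ∧
      Ideal.span {c' 1} = Ideal.span {u' 0} ∧
      c' 1 = φ (c 1) ∧ φ (c 0) = φ (c 1) * c' 0 ∧ c' 2 = φ (c 2) := by
  classical
  have hci : ∀ i, c i ∈ maximalIdeal R := fun i => by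
    rw [← hgen]; exact Ideal.subset_span (by fin_cases i <;> simp)
  have hu'i : ∀ i, u' i ∈ maximalIdeal R' := fun i => by
    rw [← hu']; exact Ideal.subset_span (by fin_cases i <;> simp)
  have h1𝔪 : (1 : R) ∉ maximalIdeal R := fun h =>
    (maximalIdeal.isMaximal R).ne_top ((Ideal.eq_top_iff_one _).mpr h)
  -- `x = γ u₀ + δ u₁`, `u₀ = p z + q x`
  have hx : c 1 ∈ Ideal.span ({u 0, u 1} : Set R) := by rw [← hP]; exact Ideal.subset_span (by simp)
  obtain ⟨γ, δ, hγδ⟩ := Ideal.mem_span_pair.mp hx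
  have hu0 : u 0 ∈ Ideal.span ({c 0, c 1} : Set R) := by rw [hP]; exact Ideal.subset_span (by simp)
  obtain ⟨p, q, hpq⟩ := Ideal.mem_span_pair.mp hu0
  -- `γ` is a unit
  have hγ : IsUnit γ := by
    have hlin : (![p * α + q * γ - 1, p * β + q * δ, 0] : Fin 3 → R) 0 * u 0 +
        (![p * α + q * γ - 1, p * β + q * δ, 0] : Fin 3 → R) 1 * u 1 +
        (![p * α + q * γ - 1, p * β + q * δ, 0] : Fin 3 → R) 2 * u 2 ∈ maximalIdeal R ^ 2 := by
      have : (![p * α + q * γ - 1, p * β + q * δ, 0] : Fin 3 → R) 0 * u 0 +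
          (![p * α + q * γ - 1, p * β + q * δ, 0] : Fin 3 → R) 1 * u 1 +
          (![p * α + q * γ - 1, p * β + q * δ, 0] : Fin 3 → R) 2 * u 2 = 0 := by
        simp; rw [← hz, ← hγδ] at hpq; linear_combination hpq
      rw [this]; exact Ideal.zero_mem _
    have h01 := mem_maximalIdeal_of_lin_mem_sq u hu hdim _ hlin 0
    simp at h01
    by_contra hγu
    have hγ𝔪 : γ ∈ maximalIdeal R := (mem_maximalIdeal _).mpr hγu
    apply h1𝔪
    have := Ideal.sub_mem _ (Ideal.add_mem _ (Ideal.mul_mem_left _ p hα) (Ideal.mul_mem_left _ q hγ𝔪)) h01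
    simp at this
  -- `β` is a unit
  have hβ : IsUnit β := by
    by_contra hβu
    have hβ𝔪 : β ∈ maximalIdeal R := (mem_maximalIdeal _).mpr hβu
    have hui : ∀ i, u i ∈ maximalIdeal R := fun i => by
      rw [← hu]; exact Ideal.subset_span (by fin_cases i <;> simp)
    have hz2 : c 0 ∈ maximalIdeal R ^ 2 := by
      rw [← hz, pow_two]
      exact Ideal.add_mem _ (Ideal.mul_mem_mul hα (hui 0)) (Ideal.mul_mem_mul hβ𝔪 (hui 1))
    have := mem_maximalIdeal_of_lin_mem_sq c hgen hdim ![1, 0, 0] (by simpa using hz2) 0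
    simp at this
  -- `y = e u₀ + f u₁ + s u₂` with `s` a unit
  have hy : c 2 ∈ Ideal.span ({u 0, u 1, u 2} : Set R) := by rw [hu]; exact hci 2
  obtain ⟨e, f, s, hefs⟩ := Submodule.mem_span_triple.mp hy
  simp only [smul_eq_mul] at hefs
  have hs : IsUnit s := by
    have hu2 : u 2 ∈ Ideal.span ({c 0, c 1, c 2} : Set R) := by
      rw [hgen, ← hu]; exact Ideal.subset_span (by simp)
    obtain ⟨p', q', t, hpqt⟩ := Submodule.mem_span_triple.mp hu2
    simp only [smul_eq_mul] at hpqt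
    have hPmem : p' * c 0 + q' * c 1 ∈ Ideal.span ({u 0, u 1} : Set R) := by
      rw [← hP]
      exact Ideal.add_mem _ (Ideal.mul_mem_left _ _ (Ideal.subset_span (by simp)))
        (Ideal.mul_mem_left _ _ (Ideal.subset_span (by simp)))
    obtain ⟨A, B, hAB⟩ := Ideal.mem_span_pair.mp hPmem
    have hlin : (![A + t * e, B + t * f, t * s - 1] : Fin 3 → R) 0 * u 0 +
        (![A + t * e, B + t * f, t * s - 1] : Fin 3 → R) 1 * u 1 +
        (![A + t * e, B + t * f, t * s - 1] : Fin 3 → R) 2 * u 2 ∈ maximalIdeal R ^ 2 := by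
      have : (![A + t * e, B + t * f, t * s - 1] : Fin 3 → R) 0 * u 0 +
          (![A + t * e, B + t * f, t * s - 1] : Fin 3 → R) 1 * u 1 +
          (![A + t * e, B + t * f, t * s - 1] : Fin 3 → R) 2 * u 2 = 0 := by
        simp; rw [← hefs] at hpqt; linear_combination hpqt + hAB
      rw [this]; exact Ideal.zero_mem _
    have h2 := mem_maximalIdeal_of_lin_mem_sq u hu hdim _ hlin 2
    simp at h2
    by_contra hsu
    have hs𝔪 : s ∈ maximalIdeal R := (mem_maximalIdeal _).mpr hsu
    apply h1𝔪
    have := Ideal.sub_mem _ (Ideal.mul_mem_left _ t hs𝔪) h2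
    simp at this
  -- the images
  set wx : R' := φ γ + φ δ * u' 1 with hwx
  have hφx : φ (c 1) = u' 0 * wx := by rw [← hγδ]; simp only [map_add, map_mul, h0, h1, hwx]; ring
  have hwxU : IsUnit wx :=
    isUnit_add_of_mem_maximalIdeal (hγ.map φ) (Ideal.mul_mem_left _ _ (hu'i 1))
  obtain ⟨ι, hι⟩ := hwxU.exists_left_inv
  have hφz : φ (c 0) = u' 0 * (φ α + φ β * u' 1) := by
    rw [← hz]; simp only [map_add, map_mul, h0, h1]; ring
  have hφy : φ (c 2) = u' 0 * (φ e + φ f * u' 1) + φ s * u' 2 := by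
    rw [← hefs]; simp only [map_add, map_mul, h0, h1, h2]; ring
  refine ⟨![ι * (φ α + φ β * u' 1), φ (c 1), φ (c 2)], ?_, ?_, by simp, ?_, by simp⟩
  · show Ideal.span {ι * (φ α + φ β * u' 1), φ (c 1), φ (c 2)} = maximalIdeal R'
    apply le_antisymm
    · rw [Ideal.span_le]
      rintro v hv
      simp only [Set.mem_insert_iff, Set.mem_singleton_iff] at hv
      rcases hv with rfl | rfl | rfl
      · exact Ideal.mul_mem_left _ _
          (add_mem (map_nonunit φ α hα) (Ideal.mul_mem_left _ _ (hu'i 1)))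
      · exact map_nonunit φ _ (hci 1)
      · exact map_nonunit φ _ (hci 2)
    · set S : Ideal R' := Ideal.span {ι * (φ α + φ β * u' 1), φ (c 1), φ (c 2)} with hS
      have hz₁S : ι * (φ α + φ β * u' 1) ∈ S := Ideal.subset_span (by simp)
      have hx₁S : φ (c 1) ∈ S := Ideal.subset_span (by simp)
      have hy₁S : φ (c 2) ∈ S := Ideal.subset_span (by simp)
      have hu0S : u' 0 ∈ S := by
        have : u' 0 = ι * φ (c 1) := by rw [hφx]; linear_combination (-(u' 0)) * hι
        rw [this]; exact Ideal.mul_mem_left _ _ hx₁S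
      have hu2S : u' 2 ∈ S := by
        obtain ⟨σ, hσ⟩ := (hs.map φ).exists_left_inv
        have : u' 2 = σ * (φ (c 2) - u' 0 * (φ e + φ f * u' 1)) := by
          rw [hφy]; linear_combination (-(u' 2)) * hσ
        rw [this]
        exact Ideal.mul_mem_left _ _ (Ideal.sub_mem _ hy₁S (Ideal.mul_mem_right _ _ hu0S))
      have hαS : φ α ∈ S := by
        have hα' : α ∈ Ideal.span ({u 0, u 1, u 2} : Set R) := by rw [hu]; exact hα
        obtain ⟨a0, a1, a2, ha⟩ := Submodule.mem_span_triple.mp hα'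
        simp only [smul_eq_mul] at ha
        have : φ α = u' 0 * (φ a0 + φ a1 * u' 1) + φ a2 * u' 2 := by
          rw [← ha]; simp only [map_add, map_mul, h0, h1, h2]; ring
        rw [this]
        exact Ideal.add_mem _ (Ideal.mul_mem_right _ _ hu0S) (Ideal.mul_mem_left _ _ hu2S)
      have hu1S : u' 1 ∈ S := by
        obtain ⟨τ, hτ⟩ := (hβ.map φ).exists_left_inv
        have : u' 1 = τ * (wx * (ι * (φ α + φ β * u' 1)) - φ α) := by
          linear_combination (-(u' 1)) * hτ - (τ * (φ α + φ β * u' 1)) * hι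
        rw [this]
        exact Ideal.mul_mem_left _ _ (Ideal.sub_mem _ (Ideal.mul_mem_left _ _ hz₁S) hαS)
      rw [← hu', Ideal.span_le]
      rintro v hv
      simp only [Set.mem_insert_iff, Set.mem_singleton_iff] at hv
      rcases hv with rfl | rfl | rfl
      · exact hu0S
      · exact hu1S
      · exact hu2S
  · show Ideal.span {φ (c 1)} = Ideal.span {u' 0}
    rw [hφx]; exact Ideal.span_singleton_mul_right_unit hwxU _
  · show φ (c 0) = φ (c 1) * (ι * (φ α + φ β * u' 1))
    rw [hφz, hφx]; linear_combination (-(u' 0 * (φ α + φ β * u' 1))) * hι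

end Present

end Literature.AlgebraicGeometry.Resolution
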